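import Mathlib.RingTheory.Algebraic.Integral
import Literature.NumberTheory.Transcendental.AnalyticSubgroupElliptic
import Literature.NumberTheory.EllipticCurves.WeierstrassAdditionProofs
import HarnessLib

/-!
# `ℚ̄`-points of the universal vectorial extension form a group

Topic `Literature/NumberTheory/Transcendental`. For a period pair `L` (Mathlib `PeriodPair`) with
algebraic invariants `g₂(L), g₃(L)`, the predicate `PeriodPair.IsUnivExtAlgPoint L z t` of
`AnalyticSubgroupElliptic.lean` says that `(z, t) ∈ Lie E♮_ℂ = ℂ²` exponentiates to a
`ℚ̄`-rational point of the universal vectorial extension `E♮` of `E : y² = 4x³ - g₂x - g₃`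
(either `z ∈ Λ` and `t - η(z) ∈ ℚ̄`, or `z ∉ Λ` and `℘(z), t - ζ(z) ∈ ℚ̄`).  We prove that these
points form a subgroup of `ℂ²`:

* `PeriodPair.IsUnivExtAlgPoint.neg`, `.add`, `.sub`, `.int_mul`,

i.e. that the group law of `E♮` is defined over `ℚ̄` in the Weierstrass coordinates
`(℘(z), ℘'(z), t - ζ(z))` — the input "`exp_G(su) ∈ G(ℚ̄)` for all integers `s`" of Baker's
method on `G = 𝔾ₐ × 𝔾ₘ^ι × (E♮)^κ` (Baker–Wüstholz 2007, §6.2 and proof of Thm. 6.3; node L1b of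
the decomposition of `Literature.NumberTheory.Transcendental.analyticSubgroupTheorem_GaGmE_periods`).  Everything is derived
from the addition theorems for `℘` and `ζ` and the duplication formulas, now proved in
`WeierstrassAdditionProofs.lean`, the quasi-periodicity `ζ(z + mω₁ + nω₂) = ζ(z) + mη₁ + nη₂`,
and the algebraicity of `℘'(z)` (`℘'² = 4℘³ - g₂℘ - g₃`) and `℘''(z) = 6℘(z)² - g₂/2` at points
with `℘(z) ∈ ℚ̄` (`isAlgebraic_derivWeierstrassP`, `isAlgebraic_deriv_derivWeierstrassP`).

## References

* A. Baker, G. Wüstholz, *Logarithmic Forms and Diophantine Geometry*, CUP 2007, §6.2 and the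
  proof of Thm. 6.3 (coordinates `℘(z_j), ℘'(z_j), z₋₁ + M″(ζ(z₁), …, ζ(zₙ))` of `exp_G`).
* A. Huber, G. Wüstholz, *Transcendence and Linear Relations of 1-Periods*, CUP 2022, §18.1–18.2.
* J. V. Armitage, W. F. Eberlein, *Elliptic Functions*, CUP 2006, §7.4 (addition theorems).
-/

noncomputable section

open Complex

namespace PeriodPair

variable (L : PeriodPair)

/-! ### Algebraic values of `℘'` and `℘''` -/

/-- If `g₂, g₃` and `℘(z)` are algebraic (`z ∉ Λ`), so is `℘'(z)`, a square root of
`4℘(z)³ - g₂℘(z) - g₃` (Baker–Wüstholz §6.2: the coordinates `℘(u), ℘'(u)` of an algebraic point).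
[folklore] -/
theorem isAlgebraic_derivWeierstrassP {z : ℂ} (hz : z ∉ L.lattice) (h₂ : IsAlgebraic ℚ L.g₂)
    (h₃ : IsAlgebraic ℚ L.g₃) (h℘ : IsAlgebraic ℚ (℘[L] z)) : IsAlgebraic ℚ (℘'[L] z) := by
  have hsq : IsAlgebraic ℚ (℘'[L] z ^ 2) := by
    rw [L.derivWeierstrassP_sq z hz]
    exact (((isAlgebraic_int 4).mul (h℘.pow 3)).sub (h₂.mul h℘)).sub h₃
  rw [isAlgebraic_iff_isIntegral] at hsq ⊢
  exact IsIntegral.of_pow two_pos hsq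

/-- If `g₂` and `℘(z)` are algebraic (`z ∉ Λ`), so is `℘''(z) = 6℘(z)² - g₂/2`. [folklore] -/
theorem isAlgebraic_deriv_derivWeierstrassP {z : ℂ} (hz : z ∉ L.lattice)
    (h₂ : IsAlgebraic ℚ L.g₂) (h℘ : IsAlgebraic ℚ (℘[L] z)) :
    IsAlgebraic ℚ (deriv ℘'[L] z) := by
  have e : deriv ℘'[L] z = 6 * ℘[L] z ^ 2 - (2 : ℚ)⁻¹ • L.g₂ := by
    rw [L.deriv_derivWeierstrassP hz, Rat.smul_def]
    push_cast
    ring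
  rw [e]
  exact ((isAlgebraic_int 6).mul (h℘.pow 2)).sub (h₂.smul _)

end PeriodPair

namespace PeriodPair

variable {L : PeriodPair}

/-! ### `E♮(ℚ̄)` is a subgroup -/

/-- The inverse of a `ℚ̄`-point of `E♮` is a `ℚ̄`-point: `(z, t) ↦ (-z, -t)` (`℘` even, `ζ` odd).
[folklore] -/
theorem IsUnivExtAlgPoint.neg {z t : ℂ} (h : L.IsUnivExtAlgPoint z t) :
    L.IsUnivExtAlgPoint (-z) (-t) := by
  rcases h with ⟨m, n, rfl, ha⟩ | ⟨hz, h℘, hζ⟩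
  · refine Or.inl ⟨-m, -n, by push_cast; ring, ?_⟩
    have e : -t - ((-m : ℤ) * L.η₁ + (-n : ℤ) * L.η₂) = -(t - (m * L.η₁ + n * L.η₂)) := by
      push_cast; ring
    rw [e]
    exact ha.neg
  · refine Or.inr ⟨fun h => hz (by simpa using neg_mem h), by rwa [L.weierstrassP_neg], ?_⟩
    have e : -t - L.weierstrassZeta (-z) = -(t - L.weierstrassZeta z) := by
      rw [L.weierstrassZeta_neg]; ring
    rw [e]
    exact hζ.neg

/-- Adding a point of `𝔾ₐ(ℚ̄) ⊂ E♮(ℚ̄)` above a period, `(mω₁ + nω₂, t₂)` with `t₂ - (mη₁ + nη₂)`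
algebraic, to a point `(z₁, t₁)` with `z₁ ∉ Λ`: `℘` is unchanged and `ζ` shifts by `mη₁ + nη₂`
(`PeriodPair.weierstrassZeta_add_period`). [folklore] -/
theorem IsUnivExtAlgPoint.add_of_notMem_of_mem {z₁ t₁ t₂ : ℂ} {m n : ℤ} (hz₁ : z₁ ∉ L.lattice)
    (h℘ : IsAlgebraic ℚ (℘[L] z₁)) (hζ : IsAlgebraic ℚ (t₁ - L.weierstrassZeta z₁))
    (ht₂ : IsAlgebraic ℚ (t₂ - (m * L.η₁ + n * L.η₂))) :
    L.IsUnivExtAlgPoint (z₁ + (m * L.ω₁ + n * L.ω₂)) (t₁ + t₂) := by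
  have hl := L.int_mul_add_int_mul_mem_lattice m n
  refine Or.inr ⟨fun h => hz₁ (by simpa using sub_mem h hl), ?_, ?_⟩
  · rwa [← Subtype.coe_mk _ hl, L.weierstrassP_add_coe]
  · have e : t₁ + t₂ - L.weierstrassZeta (z₁ + (m * L.ω₁ + n * L.ω₂)) =
        (t₁ - L.weierstrassZeta z₁) + (t₂ - (m * L.η₁ + n * L.η₂)) := by
      rw [L.weierstrassZeta_add_period]; ring
    rw [e]
    exact hζ.add ht₂

/-- **`E♮(ℚ̄)` is closed under addition** (for algebraic `g₂, g₃`): if `(z₁, t₁)` and `(z₂, t₂)`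
exponentiate to `ℚ̄`-points of the universal vectorial extension, so does `(z₁ + z₂, t₁ + t₂)`.
Case by case: two period vectors add; a period vector shifts `ζ` by its quasi-period; for
`z₁, z₂ ∉ Λ` with `z₁ + z₂ ∈ Λ` the sum lies in `𝔾ₐ` with coordinate
`(t₁ - ζ(z₁)) + (t₂ - ζ(z₂))`; for `z₁ ≡ z₂` the duplication formulas
(`PeriodPair.weierstrassP_two_mul_holds`, `PeriodPair.weierstrassZeta_two_mul`, with
`℘''(z)/℘'(z)` algebraic); otherwise the addition theorems (`PeriodPair.weierstrassP_add_holds`,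
`PeriodPair.weierstrassZeta_add_holds`: `t₁ + t₂ - ζ(z₁ + z₂) = (t₁ - ζ z₁) + (t₂ - ζ z₂) - ½R`,
`℘(z₁ + z₂) = ¼R² - ℘(z₁) - ℘(z₂)`, `R = (℘'(z₁) - ℘'(z₂))/(℘(z₁) - ℘(z₂)) ∈ ℚ̄`).  This is the
statement that the group law of `E♮` is defined over `ℚ̄` in the coordinates `(℘, ℘', t - ζ)`
(Baker–Wüstholz 2007, proof of Thm. 6.3; Huber–Wüstholz 2022, §18.1–18.2).
[cite: BakerWustholz2007, proof of Thm. 6.3] -/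
theorem IsUnivExtAlgPoint.add (h₂ : IsAlgebraic ℚ L.g₂) (h₃ : IsAlgebraic ℚ L.g₃)
    {z₁ t₁ z₂ t₂ : ℂ} (h1 : L.IsUnivExtAlgPoint z₁ t₁) (h2 : L.IsUnivExtAlgPoint z₂ t₂) :
    L.IsUnivExtAlgPoint (z₁ + z₂) (t₁ + t₂) := by
  rcases h1 with ⟨m₁, n₁, rfl, ha₁⟩ | ⟨hz₁, h℘₁, hζ₁⟩ <;>
    rcases h2 with ⟨m₂, n₂, rfl, ha₂⟩ | ⟨hz₂, h℘₂, hζ₂⟩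
  · -- lattice + lattice
    refine Or.inl ⟨m₁ + m₂, n₁ + n₂, by push_cast; ring, ?_⟩
    have e : t₁ + t₂ - (((m₁ + m₂ : ℤ) : ℂ) * L.η₁ + ((n₁ + n₂ : ℤ) : ℂ) * L.η₂) =
        (t₁ - (m₁ * L.η₁ + n₁ * L.η₂)) + (t₂ - (m₂ * L.η₁ + n₂ * L.η₂)) := by
      push_cast; ring
    rw [e]
    exact ha₁.add ha₂
  · -- lattice + generic
    have := IsUnivExtAlgPoint.add_of_notMem_of_mem (t₂ := t₁) hz₂ h℘₂ hζ₂ ha₁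
    rwa [add_comm z₂, add_comm t₂] at this
  · -- generic + lattice
    exact IsUnivExtAlgPoint.add_of_notMem_of_mem hz₁ h℘₁ hζ₁ ha₂
  · -- generic + generic
    by_cases hsum : z₁ + z₂ ∈ L.lattice
    · -- `z₁ + z₂ = l ∈ Λ`: the point is `t₁ + t₂ - η(l) ∈ 𝔾ₐ`
      obtain ⟨m, n, hl⟩ := PeriodPair.mem_lattice.mp hsum
      refine Or.inl ⟨m, n, hl.symm, ?_⟩
      have hz₂' : z₂ = -z₁ + (m * L.ω₁ + n * L.ω₂) := by linear_combination -hl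
      have hζ : L.weierstrassZeta z₁ + L.weierstrassZeta z₂ = m * L.η₁ + n * L.η₂ := by
        rw [hz₂', L.weierstrassZeta_add_period, L.weierstrassZeta_neg]
        ring
      have e : t₁ + t₂ - (m * L.η₁ + n * L.η₂) =
          (t₁ - L.weierstrassZeta z₁) + (t₂ - L.weierstrassZeta z₂) := by
        linear_combination hζ
      rw [e]
      exact hζ₁.add hζ₂
    by_cases hne : ℘[L] z₁ = ℘[L] z₂
    · -- `z₁ ≡ z₂ (mod Λ)`: duplication formulas
      have hdiff : z₁ - z₂ ∈ L.lattice :=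
        ((L.weierstrassP_eq_weierstrassP_iff hz₁ hz₂).mp hne).resolve_left hsum
      obtain ⟨m, n, hl⟩ := PeriodPair.mem_lattice.mp hdiff
      have e : z₁ = z₂ + (m * L.ω₁ + n * L.ω₂) := by linear_combination -hl
      have esum : z₁ + z₂ = 2 * z₂ + (m * L.ω₁ + n * L.ω₂) := by linear_combination e
      have h2z : 2 * z₂ ∉ L.lattice := by
        intro h
        apply hsum
        rw [esum]
        exact add_mem h (L.int_mul_add_int_mul_mem_lattice m n)
      have h' : ℘'[L] z₂ ≠ 0 := fun h0 =>
        h2z (L.two_mul_mem_lattice_of_derivWeierstrassP_eq_zero hz₂ h0)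
      have hP2 := L.weierstrassP_two_mul_holds z₂ hz₂ h'
      have hZ2 := L.weierstrassZeta_two_mul hz₂ h'
      have hratio : IsAlgebraic ℚ (deriv ℘'[L] z₂ / ℘'[L] z₂) :=
        (L.isAlgebraic_deriv_derivWeierstrassP hz₂ h₂ h℘₂).mul
          (IsAlgebraic.inv_iff.mpr (L.isAlgebraic_derivWeierstrassP hz₂ h₂ h₃ h℘₂))
      refine Or.inr ⟨hsum, ?_, ?_⟩
      · have eP : ℘[L] (z₁ + z₂) = (4 : ℚ)⁻¹ • (deriv ℘'[L] z₂ / ℘'[L] z₂) ^ 2 - 2 * ℘[L] z₂ := by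
          rw [esum, ← Subtype.coe_mk _ (L.int_mul_add_int_mul_mem_lattice m n),
            L.weierstrassP_add_coe, hP2, Rat.smul_def]
          push_cast
          ring
        rw [eP]
        exact ((hratio.pow 2).smul _).sub ((isAlgebraic_int 2).mul h℘₂)
      · have hζ₁' : IsAlgebraic ℚ (t₁ - L.weierstrassZeta z₂ - (m * L.η₁ + n * L.η₂)) := by
          have e1 : t₁ - L.weierstrassZeta z₂ - (m * L.η₁ + n * L.η₂) =
              t₁ - L.weierstrassZeta z₁ := by
            rw [e, L.weierstrassZeta_add_period]; ring
          rw [e1]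
          exact hζ₁
        have eZ : t₁ + t₂ - L.weierstrassZeta (z₁ + z₂) =
            (t₁ - L.weierstrassZeta z₂ - (m * L.η₁ + n * L.η₂)) + (t₂ - L.weierstrassZeta z₂) -
              (2 : ℚ)⁻¹ • (deriv ℘'[L] z₂ / ℘'[L] z₂) := by
          rw [esum, L.weierstrassZeta_add_period, hZ2, Rat.smul_def]
          push_cast
          ring
        rw [eZ]
        exact (hζ₁'.add hζ₂).sub (hratio.smul _)
    · -- generic case: addition theorems
      have hP := L.weierstrassP_add_holds z₁ z₂ hz₁ hz₂ hne
      have hZ := L.weierstrassZeta_add_holds z₁ z₂ hz₁ hz₂ hne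
      have hR : IsAlgebraic ℚ ((℘'[L] z₁ - ℘'[L] z₂) / (℘[L] z₁ - ℘[L] z₂)) :=
        ((L.isAlgebraic_derivWeierstrassP hz₁ h₂ h₃ h℘₁).sub
          (L.isAlgebraic_derivWeierstrassP hz₂ h₂ h₃ h℘₂)).mul
          (IsAlgebraic.inv_iff.mpr (h℘₁.sub h℘₂))
      refine Or.inr ⟨hsum, ?_, ?_⟩
      · have eP : ℘[L] (z₁ + z₂) =
            (4 : ℚ)⁻¹ • ((℘'[L] z₁ - ℘'[L] z₂) / (℘[L] z₁ - ℘[L] z₂)) ^ 2 - ℘[L] z₁ - ℘[L] z₂ := by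
          rw [hP, Rat.smul_def]
          push_cast
          ring
        rw [eP]
        exact (((hR.pow 2).smul _).sub h℘₁).sub h℘₂
      · have eZ : t₁ + t₂ - L.weierstrassZeta (z₁ + z₂) =
            (t₁ - L.weierstrassZeta z₁) + (t₂ - L.weierstrassZeta z₂) -
              (2 : ℚ)⁻¹ • ((℘'[L] z₁ - ℘'[L] z₂) / (℘[L] z₁ - ℘[L] z₂)) := by
          rw [hZ, Rat.smul_def]
          push_cast
          ring
        rw [eZ]
        exact (hζ₁.add hζ₂).sub (hR.smul _)

/-- `E♮(ℚ̄)` is closed under subtraction. [folklore] -/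
theorem IsUnivExtAlgPoint.sub (h₂ : IsAlgebraic ℚ L.g₂) (h₃ : IsAlgebraic ℚ L.g₃)
    {z₁ t₁ z₂ t₂ : ℂ} (h1 : L.IsUnivExtAlgPoint z₁ t₁) (h2 : L.IsUnivExtAlgPoint z₂ t₂) :
    L.IsUnivExtAlgPoint (z₁ - z₂) (t₁ - t₂) := by
  simpa [sub_eq_add_neg] using h1.add h₂ h₃ h2.neg

/-- `E♮(ℚ̄)` is closed under integer multiples: `(kz, kt)` is a `ℚ̄`-point whenever `(z, t)` is —
in particular the multiples `s·u` of the point `u` of the analytic subgroup theorem exponentiate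
to algebraic points, as Baker's method requires. [folklore] -/
theorem IsUnivExtAlgPoint.int_mul (h₂ : IsAlgebraic ℚ L.g₂) (h₃ : IsAlgebraic ℚ L.g₃) {z t : ℂ}
    (h : L.IsUnivExtAlgPoint z t) (k : ℤ) : L.IsUnivExtAlgPoint (k * z) (k * t) := by
  induction k using Int.induction_on with
  | zero => simpa using L.isUnivExtAlgPoint_zero
  | succ n ih =>
    have := ih.add h₂ h₃ h
    have e1 : (((n : ℤ) + 1 : ℤ) : ℂ) * z = (n : ℤ) * z + z := by push_cast; ring
    have e2 : (((n : ℤ) + 1 : ℤ) : ℂ) * t = (n : ℤ) * t + t := by push_cast; ring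
    rwa [e1, e2]
  | pred n ih =>
    have := ih.sub h₂ h₃ h
    have e1 : ((-(n : ℤ) - 1 : ℤ) : ℂ) * z = (-(n : ℤ) : ℤ) * z - z := by push_cast; ring
    have e2 : ((-(n : ℤ) - 1 : ℤ) : ℂ) * t = (-(n : ℤ) : ℤ) * t - t := by push_cast; ring
    rwa [e1, e2]

end PeriodPair

end
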